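import Literature.AlgebraicGeometry.HodgeTheory.LefschetzFormIndexRealHodgeTypes
import HarnessLib

/-!
# The index of the real Lefschetz form on `(H^{p,q} ⊕ H^{q,p})_ℝ`, in Hodge numbers

Family `hodge`, layer `Literature/AlgebraicGeometry/HodgeTheory`; lane `lit-hodgefound`. THEOREMS
ONLY (no definition, no named fact; D-0026). The last piece of the "index in Hodge numbers" series of
`LefschetzFormIndexRealHodgeTypes.lean` (`H^{p,p}_ℝ`: `signature_lefschetzForm_restrict_pp_eq_sum_hodgeNumber`;
`(H^{p,q} ⊕ H^{q,p})_ℝ` as BLOCK sums: `sigPos_sigNeg_lefschetzForm_restrict_pq_of_pos`) and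
`LefschetzFormIndexRealPrimitive.lean` (`P^k_ℝ`).

Let `X` be smooth projective of dimension `n = k + r`, `k = p + q` EVEN with `p < q`, `D` a
Kähler–rational datum (`κ = re H_η`), `μ` a `ℤ`-orientation of `X(ℂ)` pairing positively with the volume
class, `B_k(y, y') = ⟨Lʳ_κ y ⌣ y', [X(ℂ)]_μ ⊗ 1⟩`, and `U = (H^{p,q} ⊕ H^{q,p})_ℝ` the real classes of
type `(p,q) + (q,p)`. In the Lefschetz decomposition `U = ⊕_{j ≤ p} Lʲ (P^{p-j,q-j} ⊕ P^{q-j,p-j})_ℝ`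
the form `(-1)^{p-j} B_k` is positive definite on the `j`-th summand (Voisin, Thm. 6.32; Carlson–
Müller-Stach–Peters §4.4: "signature `(-1)^{p-m}` on `H^{p,q} ⊕ H^{q,p}`"), whose real dimension is
`2 dim_ℂ P^{p-j,q-j} = 2 (h^{p-j,q-j} - h^{p-j-1,q-j-1})` (Hodge symmetry `h^{s,t} = h^{t,s}`). Hence,
with `s = p - j`:

* `KaehlerRationalDatum.signature_lefschetzForm_restrict_pq_eq_sum_hodgeNumber` —
  **`b⁺(B_k|U) = 2 Σ_{s ≤ p, s even} (h^{s, s+q-p} - [s > 0] h^{s-1, s+q-p-1})`**, `b⁻(B_k|U)` = the same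
  sum over odd `s`, and `b⁺ + b⁻ = 2 h^{p,q}`;
* `KaehlerRationalDatum.sigPos_sigNeg_lefschetzForm_restrict_extremeTypes_of_pos` — `p = 0`:
  **`(H^{k,0} ⊕ H^{0,k})_ℝ` is `B_k`-positive definite** for every even `k ≥ 2`: `b⁺ = 2 h^{0,k}`,
  `b⁻ = 0`.

## References

* [VoisinHodgeI2002] C. Voisin, Hodge Theory and Complex Algebraic Geometry I, §6.3.2 Thm. 6.32.
* [CarlsonMullerStachPeters2017] J. Carlson, S. Müller-Stach, C. Peters, Period Mappings and Period
  Domains (2nd ed.), §4.4 (p. 138).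
* [HuybrechtsCG2005] D. Huybrechts, Complex Geometry, Prop. 3.3.15 and Cor. 3.3.18 (proof, pp. 164–165).
-/

noncomputable section

open scoped Manifold ContDiff
open CategoryTheory AlgebraicGeometry Module Bundle Finset
open Literature.AlgebraicTopology.SingularHomology Literature.Geometry.Kaehler
open Literature.NumberTheory.Transcendental
open Literature.AlgebraicGeometry.Motives (IsSmoothProjective)

namespace Literature.AlgebraicGeometry.HodgeTheory

section HodgePairs

variable {n : ℕ} {X : Motives.SchemeOver ℂ}

/-! ### Reindexing the two block families by `s = p - j` -/

/-- The blocks `Lʲ P^{p-j,q-j}` of type `(p, q)`: with `s = p - j` the block `P = (deg, j)`,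
`(s', t')` with `(s' + j, t' + j) = (p, q)` is `deg = s + (s + d)`, `(s', t') = (s, s + d)`,
`d = q - p`; a block sum with a Kronecker-delta condition is the sum over `s ≤ p`. [folklore] -/
private theorem sum_sum_ite_type_lo_eq {k p q d : ℕ} (hd : p + d = q) (hk : p + q = k)
    (g : ∀ a : ℕ, ↥(Finset.HasAntidiagonal.antidiagonal a) → ℕ) (c : ℕ → Prop) [DecidablePred c] :
    ∑ P : {x : ℕ × ℕ // x.1 + 2 * x.2 = k}, ∑ st : ↥(Finset.HasAntidiagonal.antidiagonal P.1.1),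
        (if (st.1.1 + P.1.2, st.1.2 + P.1.2) = (p, q) ∧ c st.1.1 then g P.1.1 st else 0) =
      ∑ s ∈ Finset.range (p + 1),
        if c s then g (s + (s + d)) ⟨(s, s + d), Finset.HasAntidiagonal.mem_antidiagonal.2 rfl⟩
        else 0 := by
  classical
  have hδ : ∀ (P : {x : ℕ × ℕ // x.1 + 2 * x.2 = k})
      (st : ↥(Finset.HasAntidiagonal.antidiagonal P.1.1)),
      (if (st.1.1 + P.1.2, st.1.2 + P.1.2) = (p, q) ∧ c st.1.1 then g P.1.1 st else 0) =
        ∑ s ∈ Finset.range (p + 1),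
          if P.1 = (s + (s + d), p - s) ∧ st.1 = (s, s + d) then (if c s then g P.1.1 st else 0)
          else 0 := by
    intro P st
    have hP := P.2
    have hst := Finset.HasAntidiagonal.mem_antidiagonal.1 st.2
    by_cases h : (st.1.1 + P.1.2, st.1.2 + P.1.2) = (p, q)
    · have h' := h
      simp only [Prod.mk.injEq] at h'
      have hj : st.1.1 ∈ Finset.range (p + 1) := Finset.mem_range.2 (by omega)
      have hidx : P.1 = (st.1.1 + (st.1.1 + d), p - st.1.1) ∧ st.1 = (st.1.1, st.1.1 + d) :=
        ⟨Prod.ext (by simp only; omega) (by simp only; omega), Prod.ext rfl (by simp only; omega)⟩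
      rw [← Finset.add_sum_erase _ _ hj, if_pos hidx, Finset.sum_eq_zero fun j hj' ↦ ?_, add_zero]
      · by_cases hc : c st.1.1
        · rw [if_pos ⟨h, hc⟩, if_pos hc]
        · rw [if_neg (fun h'' ↦ hc h''.2), if_neg hc]
      · rw [if_neg]
        rintro ⟨-, h2⟩
        exact (Finset.mem_erase.1 hj').1 (by rw [h2])
    · rw [if_neg (fun h' ↦ h h'.1)]
      refine (Finset.sum_eq_zero fun j _ ↦ if_neg ?_).symm
      rintro ⟨h1, h2⟩
      apply h
      have e0 := congrArg Prod.fst h1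
      have e1 := congrArg Prod.snd h1
      have e2 := congrArg Prod.fst h2
      have e3 := congrArg Prod.snd h2
      simp only at e0 e1 e2 e3
      exact Prod.ext (by simp only; omega) (by simp only; omega)
  have step : ∀ P : {x : ℕ × ℕ // x.1 + 2 * x.2 = k},
      ∑ st : ↥(Finset.HasAntidiagonal.antidiagonal P.1.1),
          (if (st.1.1 + P.1.2, st.1.2 + P.1.2) = (p, q) ∧ c st.1.1 then g P.1.1 st else 0) =
        ∑ s ∈ Finset.range (p + 1), ∑ st : ↥(Finset.HasAntidiagonal.antidiagonal P.1.1),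
          if P.1 = (s + (s + d), p - s) ∧ st.1 = (s, s + d) then (if c s then g P.1.1 st else 0)
          else 0 :=
    fun P ↦ by rw [Finset.sum_congr rfl fun st _ ↦ hδ P st, Finset.sum_comm]
  rw [Finset.sum_congr rfl fun P _ ↦ step P, Finset.sum_comm]
  refine Finset.sum_congr rfl fun s hs ↦ ?_
  have hsp : s ≤ p := by have := Finset.mem_range.1 hs; omega
  let P₀ : {x : ℕ × ℕ // x.1 + 2 * x.2 = k} := ⟨(s + (s + d), p - s), by simp only; omega⟩
  rw [Finset.sum_eq_single P₀ (fun P _ hne ↦ Finset.sum_eq_zero fun st _ ↦ if_neg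
      (fun h ↦ hne (Subtype.ext h.1))) (fun h ↦ absurd (Finset.mem_univ _) h)]
  let st₀ : ↥(Finset.HasAntidiagonal.antidiagonal P₀.1.1) :=
    ⟨(s, s + d), Finset.HasAntidiagonal.mem_antidiagonal.2 rfl⟩
  rw [Finset.sum_eq_single st₀ (fun st _ hne ↦ if_neg (fun h ↦ hne (Subtype.ext h.2)))
      (fun h ↦ absurd (Finset.mem_univ _) h), if_pos ⟨rfl, rfl⟩]

/-- The blocks `Lʲ P^{q-j,p-j}` of type `(q, p)`: with `s = p - j`, `deg = (s + d) + s`,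
`(s', t') = (s + d, s)`, `d = q - p`. [folklore] -/
private theorem sum_sum_ite_type_hi_eq {k p q d : ℕ} (hd : p + d = q) (hk : p + q = k)
    (g : ∀ a : ℕ, ↥(Finset.HasAntidiagonal.antidiagonal a) → ℕ) (c : ℕ → Prop) [DecidablePred c] :
    ∑ P : {x : ℕ × ℕ // x.1 + 2 * x.2 = k}, ∑ st : ↥(Finset.HasAntidiagonal.antidiagonal P.1.1),
        (if (st.1.1 + P.1.2, st.1.2 + P.1.2) = (q, p) ∧ c st.1.1 then g P.1.1 st else 0) =
      ∑ s ∈ Finset.range (p + 1),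
        if c (s + d) then g (s + d + s) ⟨(s + d, s), Finset.HasAntidiagonal.mem_antidiagonal.2 rfl⟩
        else 0 := by
  classical
  have hδ : ∀ (P : {x : ℕ × ℕ // x.1 + 2 * x.2 = k})
      (st : ↥(Finset.HasAntidiagonal.antidiagonal P.1.1)),
      (if (st.1.1 + P.1.2, st.1.2 + P.1.2) = (q, p) ∧ c st.1.1 then g P.1.1 st else 0) =
        ∑ s ∈ Finset.range (p + 1),
          if P.1 = (s + d + s, p - s) ∧ st.1 = (s + d, s) then (if c (s + d) then g P.1.1 st else 0)
          else 0 := by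
    intro P st
    have hP := P.2
    have hst := Finset.HasAntidiagonal.mem_antidiagonal.1 st.2
    by_cases h : (st.1.1 + P.1.2, st.1.2 + P.1.2) = (q, p)
    · have h' := h
      simp only [Prod.mk.injEq] at h'
      have hj : st.1.2 ∈ Finset.range (p + 1) := Finset.mem_range.2 (by omega)
      have hsd : st.1.1 = st.1.2 + d := by omega
      have hidx : P.1 = (st.1.2 + d + st.1.2, p - st.1.2) ∧ st.1 = (st.1.2 + d, st.1.2) :=
        ⟨Prod.ext (by simp only; omega) (by simp only; omega), Prod.ext (by simp only; omega) rfl⟩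
      rw [← Finset.add_sum_erase _ _ hj, if_pos hidx, Finset.sum_eq_zero fun j hj' ↦ ?_, add_zero]
      · by_cases hc : c st.1.1
        · rw [if_pos ⟨h, hc⟩, ← hsd, if_pos hc]
        · rw [if_neg (fun h'' ↦ hc h''.2), ← hsd, if_neg hc]
      · rw [if_neg]
        rintro ⟨-, h2⟩
        exact (Finset.mem_erase.1 hj').1 (by rw [h2])
    · rw [if_neg (fun h' ↦ h h'.1)]
      refine (Finset.sum_eq_zero fun j _ ↦ if_neg ?_).symm
      rintro ⟨h1, h2⟩
      apply h
      have e0 := congrArg Prod.fst h1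
      have e1 := congrArg Prod.snd h1
      have e2 := congrArg Prod.fst h2
      have e3 := congrArg Prod.snd h2
      simp only at e0 e1 e2 e3
      exact Prod.ext (by simp only; omega) (by simp only; omega)
  have step : ∀ P : {x : ℕ × ℕ // x.1 + 2 * x.2 = k},
      ∑ st : ↥(Finset.HasAntidiagonal.antidiagonal P.1.1),
          (if (st.1.1 + P.1.2, st.1.2 + P.1.2) = (q, p) ∧ c st.1.1 then g P.1.1 st else 0) =
        ∑ s ∈ Finset.range (p + 1), ∑ st : ↥(Finset.HasAntidiagonal.antidiagonal P.1.1),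
          if P.1 = (s + d + s, p - s) ∧ st.1 = (s + d, s) then (if c (s + d) then g P.1.1 st else 0)
          else 0 :=
    fun P ↦ by rw [Finset.sum_congr rfl fun st _ ↦ hδ P st, Finset.sum_comm]
  rw [Finset.sum_congr rfl fun P _ ↦ step P, Finset.sum_comm]
  refine Finset.sum_congr rfl fun s hs ↦ ?_
  have hsp : s ≤ p := by have := Finset.mem_range.1 hs; omega
  let P₀ : {x : ℕ × ℕ // x.1 + 2 * x.2 = k} := ⟨(s + d + s, p - s), by simp only; omega⟩
  rw [Finset.sum_eq_single P₀ (fun P _ hne ↦ Finset.sum_eq_zero fun st _ ↦ if_neg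
      (fun h ↦ hne (Subtype.ext h.1))) (fun h ↦ absurd (Finset.mem_univ _) h)]
  let st₀ : ↥(Finset.HasAntidiagonal.antidiagonal P₀.1.1) :=
    ⟨(s + d, s), Finset.HasAntidiagonal.mem_antidiagonal.2 rfl⟩
  rw [Finset.sum_eq_single st₀ (fun st _ hne ↦ if_neg (fun h ↦ hne (Subtype.ext h.2)))
      (fun h ↦ absurd (Finset.mem_univ _) h), if_pos ⟨rfl, rfl⟩]

namespace KaehlerRationalDatum

variable (D : KaehlerRationalDatum n X)

/-! ### The index on `(H^{p,q} ⊕ H^{q,p})_ℝ` -/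

/-- **The index of `B_k` on `(H^{p,q} ⊕ H^{q,p})_ℝ`, in Hodge numbers.** Let `X` be smooth projective
of dimension `n = k + r`, `k = p + q` even, `p < q`, `D` a Kähler–rational datum (`κ = re H_η`), `μ` a
`ℤ`-orientation of `X(ℂ)` pairing positively with `y_Ω`, `B_k(y, y') = ⟨Lʳ_κ y ⌣ y', [X(ℂ)]_μ ⊗ 1⟩`
and `U` the real classes of type `(p,q) + (q,p)`. Then, with `s = p - j` indexing the Lefschetz
blocks `Lʲ (P^{p-j,q-j} ⊕ P^{q-j,p-j})_ℝ` (on which `(-1)^{p-j} B_k > 0`, of real dimension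
`2 (h^{p-j,q-j} - h^{p-j-1,q-j-1})`):
`b⁺(B_k|U) = 2 Σ_{s ≤ p, s even} (h^{s,s+q-p} - [s > 0] h^{s-1,s+q-p-1})`,
`b⁻(B_k|U) = 2 Σ_{s ≤ p, s odd} (h^{s,s+q-p} - [s > 0] h^{s-1,s+q-p-1})`, and `b⁺ + b⁻ = 2 h^{p,q}`.
[cite: VoisinHodgeI2002, §6.3.2 Thm. 6.32] [cite: CarlsonMullerStachPeters2017, §4.4 (p. 138)]
[cite: HuybrechtsCG2005, Cor. 3.3.18 (proof)] -/
theorem signature_lefschetzForm_restrict_pq_eq_sum_hodgeNumber (hX : IsSmoothProjective n X)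
    (A : HodgeModel n X) {k p q r m : ℕ} (hpq : p + q = k) (hlt : p < q) (hk : Even k)
    (hkr : k + r = n) (hm : k + 2 * r = m) (hdeg : m + k = 2 * n)
    (μ : HomologicalOrientation ℤ (Motives.ComplexPoints X) (2 * n))
    (hP : 0 < kroneckerPairing ℝ ℝ (Motives.ComplexPoints X) (2 * n)
      (reClass _ (2 * n) D.topClass)
      (singularHomology.coeffChange (Motives.ComplexPoints X)
        (algebraMap ℤ ℝ : ℤ →+* ℝ).toAddMonoidHom (2 * n) μ.fundamentalClass))
    (U : Submodule ℝ (singularCohomology ℝ ℝ (Motives.ComplexPoints X) k))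
    (hU : ∀ y, y ∈ U ↔ ofRealClass _ k y ∈
      A.typePiece k ⟨(p, q), Finset.HasAntidiagonal.mem_antidiagonal.2 hpq⟩ ⊔
        A.typePiece k ⟨(q, p), Finset.HasAntidiagonal.mem_antidiagonal.2 ((add_comm q p).trans hpq)⟩) :
    ((sigPos ((LinearMap.BilinMap.toQuadraticMap
        (((cupProduct (R := ℝ) (X := Motives.ComplexPoints X) hdeg).compr₂
          ((kroneckerPairing ℝ ℝ (Motives.ComplexPoints X) (2 * n)).flip
            (singularHomology.coeffChange (Motives.ComplexPoints X)
              (algebraMap ℤ ℝ : ℤ →+* ℝ).toAddMonoidHom (2 * n) μ.fundamentalClass))) ∘ₗ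
          lefschetzPowTo (reClass (Motives.ComplexPoints X) 2 D.Hη) r k m hm)).restrict U) : ℕ) : ℤ) =
        2 * ∑ s ∈ Finset.range (p + 1), (if s % 2 = 0 then
          (Module.finrank ℂ (A.hodgePQ (s + (s + (q - p))) s (s + (q - p))) : ℤ) -
            (if 0 < s then
              (Module.finrank ℂ (A.hodgePQ (s - 1 + (s + (q - p) - 1)) (s - 1) (s + (q - p) - 1)) : ℤ)
              else 0) else 0) ∧
      ((sigNeg ((LinearMap.BilinMap.toQuadraticMap
        (((cupProduct (R := ℝ) (X := Motives.ComplexPoints X) hdeg).compr₂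
          ((kroneckerPairing ℝ ℝ (Motives.ComplexPoints X) (2 * n)).flip
            (singularHomology.coeffChange (Motives.ComplexPoints X)
              (algebraMap ℤ ℝ : ℤ →+* ℝ).toAddMonoidHom (2 * n) μ.fundamentalClass))) ∘ₗ
          lefschetzPowTo (reClass (Motives.ComplexPoints X) 2 D.Hη) r k m hm)).restrict U) : ℕ) : ℤ) =
        2 * ∑ s ∈ Finset.range (p + 1), (if s % 2 = 1 then
          (Module.finrank ℂ (A.hodgePQ (s + (s + (q - p))) s (s + (q - p))) : ℤ) -
            (if 0 < s then
              (Module.finrank ℂ (A.hodgePQ (s - 1 + (s + (q - p) - 1)) (s - 1) (s + (q - p) - 1)) : ℤ)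
              else 0) else 0) ∧
      sigPos ((LinearMap.BilinMap.toQuadraticMap
        (((cupProduct (R := ℝ) (X := Motives.ComplexPoints X) hdeg).compr₂
          ((kroneckerPairing ℝ ℝ (Motives.ComplexPoints X) (2 * n)).flip
            (singularHomology.coeffChange (Motives.ComplexPoints X)
              (algebraMap ℤ ℝ : ℤ →+* ℝ).toAddMonoidHom (2 * n) μ.fundamentalClass))) ∘ₗ
          lefschetzPowTo (reClass (Motives.ComplexPoints X) 2 D.Hη) r k m hm)).restrict U) +
      sigNeg ((LinearMap.BilinMap.toQuadraticMap
        (((cupProduct (R := ℝ) (X := Motives.ComplexPoints X) hdeg).compr₂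
          ((kroneckerPairing ℝ ℝ (Motives.ComplexPoints X) (2 * n)).flip
            (singularHomology.coeffChange (Motives.ComplexPoints X)
              (algebraMap ℤ ℝ : ℤ →+* ℝ).toAddMonoidHom (2 * n) μ.fundamentalClass))) ∘ₗ
          lefschetzPowTo (reClass (Motives.ComplexPoints X) 2 D.Hη) r k m hm)).restrict U) =
        2 * Module.finrank ℂ (A.hodgePQ k p q) := by
  classical
  obtain ⟨h1, h2, h3⟩ := D.sigPos_sigNeg_lefschetzForm_restrict_pq_of_pos hX A hk hkr hm hdeg μ hP
    (Finset.HasAntidiagonal.mem_antidiagonal.2 hpq)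
    (Finset.HasAntidiagonal.mem_antidiagonal.2 ((add_comm q p).trans hpq)) U hU
  have hd : p + (q - p) = q := by omega
  have hqp2 : (q - p) % 2 = 0 := by obtain ⟨e, he⟩ := hk; omega
  -- the two type conditions are disjoint (`p ≠ q`)
  have hne : ∀ x : ℕ × ℕ, ¬ (x = (p, q) ∧ x = (q, p)) := by
    rintro x ⟨h1, h2⟩
    rw [h1, Prod.mk.injEq] at h2
    omega
  -- split the block sums over the two types
  have hsplit : ∀ e : ℕ, (∑ P : {x : ℕ × ℕ // x.1 + 2 * x.2 = k},
      ∑ st : ↥(Finset.HasAntidiagonal.antidiagonal P.1.1),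
        (if ((st.1.1 + P.1.2, st.1.2 + P.1.2) = (p, q) ∨ (st.1.1 + P.1.2, st.1.2 + P.1.2) = (q, p)) ∧
            st.1.1 % 2 = e then
          Module.finrank ℂ ↥(A.typePiece P.1.1 st ⊓ primitiveClasses D.Hη n P.1.1) else 0)) =
      (∑ P : {x : ℕ × ℕ // x.1 + 2 * x.2 = k},
        ∑ st : ↥(Finset.HasAntidiagonal.antidiagonal P.1.1),
          (if (st.1.1 + P.1.2, st.1.2 + P.1.2) = (p, q) ∧ st.1.1 % 2 = e then
            Module.finrank ℂ ↥(A.typePiece P.1.1 st ⊓ primitiveClasses D.Hη n P.1.1) else 0)) +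
      ∑ P : {x : ℕ × ℕ // x.1 + 2 * x.2 = k},
        ∑ st : ↥(Finset.HasAntidiagonal.antidiagonal P.1.1),
          (if (st.1.1 + P.1.2, st.1.2 + P.1.2) = (q, p) ∧ st.1.1 % 2 = e then
            Module.finrank ℂ ↥(A.typePiece P.1.1 st ⊓ primitiveClasses D.Hη n P.1.1) else 0) := by
    intro e
    rw [← Finset.sum_add_distrib]
    refine Finset.sum_congr rfl fun P _ ↦ ?_
    rw [← Finset.sum_add_distrib]
    refine Finset.sum_congr rfl fun st _ ↦ ?_
    by_cases ha : (st.1.1 + P.1.2, st.1.2 + P.1.2) = (p, q)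
    · have hb : ¬ (st.1.1 + P.1.2, st.1.2 + P.1.2) = (q, p) := fun hb ↦ hne _ ⟨ha, hb⟩
      by_cases hc : st.1.1 % 2 = e
      · rw [if_pos ⟨Or.inl ha, hc⟩, if_pos ⟨ha, hc⟩, if_neg (fun h ↦ hb h.1), add_zero]
      · rw [if_neg (fun h ↦ hc h.2), if_neg (fun h ↦ hc h.2), if_neg (fun h ↦ hc h.2), add_zero]
    · by_cases hb : (st.1.1 + P.1.2, st.1.2 + P.1.2) = (q, p)
      · by_cases hc : st.1.1 % 2 = e
        · rw [if_pos ⟨Or.inr hb, hc⟩, if_neg (fun h ↦ ha h.1), if_pos ⟨hb, hc⟩, zero_add]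
        · rw [if_neg (fun h ↦ hc h.2), if_neg (fun h ↦ hc h.2), if_neg (fun h ↦ hc h.2), add_zero]
      · rw [if_neg (fun h ↦ h.1.elim ha hb), if_neg (fun h ↦ ha h.1), if_neg (fun h ↦ hb h.1),
          add_zero]
  -- reindex by `s = p - j`
  have hlo : ∀ e : ℕ, (∑ P : {x : ℕ × ℕ // x.1 + 2 * x.2 = k},
      ∑ st : ↥(Finset.HasAntidiagonal.antidiagonal P.1.1),
        (if (st.1.1 + P.1.2, st.1.2 + P.1.2) = (p, q) ∧ st.1.1 % 2 = e then
          Module.finrank ℂ ↥(A.typePiece P.1.1 st ⊓ primitiveClasses D.Hη n P.1.1) else 0)) =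
      ∑ s ∈ Finset.range (p + 1), (if s % 2 = e then
        Module.finrank ℂ ↥(A.typePiece (s + (s + (q - p)))
            ⟨(s, s + (q - p)), Finset.HasAntidiagonal.mem_antidiagonal.2 rfl⟩ ⊓
          primitiveClasses D.Hη n (s + (s + (q - p)))) else 0) := fun e ↦
    sum_sum_ite_type_lo_eq hd hpq
      (fun a st ↦ Module.finrank ℂ ↥(A.typePiece a st ⊓ primitiveClasses D.Hη n a))
      (fun s ↦ s % 2 = e)
  have hhi : ∀ e : ℕ, (∑ P : {x : ℕ × ℕ // x.1 + 2 * x.2 = k},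
      ∑ st : ↥(Finset.HasAntidiagonal.antidiagonal P.1.1),
        (if (st.1.1 + P.1.2, st.1.2 + P.1.2) = (q, p) ∧ st.1.1 % 2 = e then
          Module.finrank ℂ ↥(A.typePiece P.1.1 st ⊓ primitiveClasses D.Hη n P.1.1) else 0)) =
      ∑ s ∈ Finset.range (p + 1), (if (s + (q - p)) % 2 = e then
        Module.finrank ℂ ↥(A.typePiece (s + (q - p) + s)
            ⟨(s + (q - p), s), Finset.HasAntidiagonal.mem_antidiagonal.2 rfl⟩ ⊓
          primitiveClasses D.Hη n (s + (q - p) + s)) else 0) := fun e ↦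
    sum_sum_ite_type_hi_eq hd hpq
      (fun a st ↦ Module.finrank ℂ ↥(A.typePiece a st ⊓ primitiveClasses D.Hη n a))
      (fun s ↦ s % 2 = e)
  -- the block dimensions in Hodge numbers
  have hblo : ∀ s ∈ Finset.range (p + 1),
      (Module.finrank ℂ ↥(A.typePiece (s + (s + (q - p)))
            ⟨(s, s + (q - p)), Finset.HasAntidiagonal.mem_antidiagonal.2 rfl⟩ ⊓
          primitiveClasses D.Hη n (s + (s + (q - p)))) : ℤ) =
        (Module.finrank ℂ (A.hodgePQ (s + (s + (q - p))) s (s + (q - p))) : ℤ) -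
          (if 0 < s then
            (Module.finrank ℂ (A.hodgePQ (s - 1 + (s + (q - p) - 1)) (s - 1) (s + (q - p) - 1)) : ℤ)
            else 0) := by
    intro s hs
    have hsn : s + (s + (q - p)) ≤ n := by have := Finset.mem_range.1 hs; omega
    rw [D.finrank_typePiece_inf_primitiveClasses_eq_sub hX A hsn]
    dsimp only
    by_cases h0 : 0 < s
    · rw [if_pos ⟨h0, by omega⟩, if_pos h0]
    · rw [if_neg (fun h ↦ h0 h.1), if_neg h0]
  have hbhi : ∀ s ∈ Finset.range (p + 1),
      (Module.finrank ℂ ↥(A.typePiece (s + (q - p) + s)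
            ⟨(s + (q - p), s), Finset.HasAntidiagonal.mem_antidiagonal.2 rfl⟩ ⊓
          primitiveClasses D.Hη n (s + (q - p) + s)) : ℤ) =
        (Module.finrank ℂ (A.hodgePQ (s + (s + (q - p))) s (s + (q - p))) : ℤ) -
          (if 0 < s then
            (Module.finrank ℂ (A.hodgePQ (s - 1 + (s + (q - p) - 1)) (s - 1) (s + (q - p) - 1)) : ℤ)
            else 0) := by
    intro s hs
    have hsn : s + (q - p) + s ≤ n := by have := Finset.mem_range.1 hs; omega
    rw [D.finrank_typePiece_inf_primitiveClasses_eq_sub hX A hsn]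
    dsimp only
    -- Hodge symmetry `h^{s+d,s} = h^{s,s+d}` and the degree spelling `(s + d) + s = s + (s + d)`
    -- (the degree rewrites are done in freshly elaborated equalities: the instance arguments of the
    -- terms produced above still mention the block index)
    have ec : (Module.finrank ℂ (A.hodgePQ (s + (q - p) + s) (s + (q - p)) s) : ℤ) =
        Module.finrank ℂ (A.hodgePQ (s + (s + (q - p))) s (s + (q - p))) := by
      rw [HodgeModel.finrank_hodgePQ_symm hX A (k := s + (q - p) + s) (p := s + (q - p)) (q := s) rfl,
        Nat.add_comm (s + (q - p)) s]
    have ec' : (Module.finrank ℂ (A.hodgePQ (s + (q - p) - 1 + (s - 1)) (s + (q - p) - 1) (s - 1)) : ℤ) =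
        Module.finrank ℂ (A.hodgePQ (s - 1 + (s + (q - p) - 1)) (s - 1) (s + (q - p) - 1)) := by
      rw [HodgeModel.finrank_hodgePQ_symm hX A (k := s + (q - p) - 1 + (s - 1)) (p := s + (q - p) - 1)
        (q := s - 1) rfl, Nat.add_comm (s + (q - p) - 1) (s - 1)]
    by_cases h0 : 0 < s
    · rw [if_pos ⟨by omega, h0⟩, if_pos h0, ec, ec']
    · rw [if_neg (fun h ↦ h0 h.2), if_neg h0, ec]
  refine ⟨?_, ?_, ?_⟩
  · rw [h1, hsplit 0, hlo 0, hhi 0, Nat.cast_add, Nat.cast_sum, Nat.cast_sum, two_mul]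
    congr 1
    · refine Finset.sum_congr rfl fun s hs ↦ ?_
      rw [Nat.cast_ite, Nat.cast_zero, hblo s hs]
    · refine Finset.sum_congr rfl fun s hs ↦ ?_
      rw [Nat.cast_ite, Nat.cast_zero, hbhi s hs]
      by_cases hs2 : s % 2 = 0
      · rw [if_pos (by omega), if_pos hs2]
      · rw [if_neg (by omega), if_neg hs2]
  · rw [h2, hsplit 1, hlo 1, hhi 1, Nat.cast_add, Nat.cast_sum, Nat.cast_sum, two_mul]
    congr 1
    · refine Finset.sum_congr rfl fun s hs ↦ ?_
      rw [Nat.cast_ite, Nat.cast_zero, hblo s hs]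
    · refine Finset.sum_congr rfl fun s hs ↦ ?_
      rw [Nat.cast_ite, Nat.cast_zero, hbhi s hs]
      by_cases hs2 : s % 2 = 1
      · rw [if_pos (by omega), if_pos hs2]
      · rw [if_neg (by omega), if_neg hs2]
  · rw [h3, finrank_real_eq_two_mul_hodgeNumber hX A (ne_of_lt hlt)
      (Finset.HasAntidiagonal.mem_antidiagonal.2 hpq)
      (Finset.HasAntidiagonal.mem_antidiagonal.2 ((add_comm q p).trans hpq)) U hU,
      A.finrank_typePiece_eq_finrank_hodgePQ]

/-- **`(H^{k,0} ⊕ H^{0,k})_ℝ` is `B_k`-positive definite** (`k ≥ 2` even, `μ` positive): the case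
`p = 0` — the only block is `(P^{0,k} ⊕ P^{k,0})_ℝ = (H^{0,k} ⊕ H^{k,0})_ℝ` with `s = 0` even, so
`b⁺ = 2 h^{0,k}` and `b⁻ = 0` (for `k = 2`: the `(2,0) + (0,2)` part of `H²` is positive for
`∫ ω^{n-2} α β`, Thm. 6.32). [cite: VoisinHodgeI2002, §6.3.2 Thm. 6.32]
[cite: CarlsonMullerStachPeters2017, §4.4 (p. 138)] -/
theorem sigPos_sigNeg_lefschetzForm_restrict_extremeTypes_of_pos (hX : IsSmoothProjective n X)
    (A : HodgeModel n X) {k r m : ℕ} (hk : Even k) (hk0 : 0 < k)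
    (hkr : k + r = n) (hm : k + 2 * r = m) (hdeg : m + k = 2 * n)
    (μ : HomologicalOrientation ℤ (Motives.ComplexPoints X) (2 * n))
    (hP : 0 < kroneckerPairing ℝ ℝ (Motives.ComplexPoints X) (2 * n)
      (reClass _ (2 * n) D.topClass)
      (singularHomology.coeffChange (Motives.ComplexPoints X)
        (algebraMap ℤ ℝ : ℤ →+* ℝ).toAddMonoidHom (2 * n) μ.fundamentalClass))
    (U : Submodule ℝ (singularCohomology ℝ ℝ (Motives.ComplexPoints X) k))
    (hU : ∀ y, y ∈ U ↔ ofRealClass _ k y ∈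
      A.typePiece k ⟨(0, k), Finset.HasAntidiagonal.mem_antidiagonal.2 (zero_add k)⟩ ⊔
        A.typePiece k ⟨(k, 0), Finset.HasAntidiagonal.mem_antidiagonal.2
          ((add_comm k 0).trans (zero_add k))⟩) :
    sigPos ((LinearMap.BilinMap.toQuadraticMap
        (((cupProduct (R := ℝ) (X := Motives.ComplexPoints X) hdeg).compr₂
          ((kroneckerPairing ℝ ℝ (Motives.ComplexPoints X) (2 * n)).flip
            (singularHomology.coeffChange (Motives.ComplexPoints X)
              (algebraMap ℤ ℝ : ℤ →+* ℝ).toAddMonoidHom (2 * n) μ.fundamentalClass))) ∘ₗ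
          lefschetzPowTo (reClass (Motives.ComplexPoints X) 2 D.Hη) r k m hm)).restrict U) =
        2 * Module.finrank ℂ (A.hodgePQ k 0 k) ∧
      sigNeg ((LinearMap.BilinMap.toQuadraticMap
        (((cupProduct (R := ℝ) (X := Motives.ComplexPoints X) hdeg).compr₂
          ((kroneckerPairing ℝ ℝ (Motives.ComplexPoints X) (2 * n)).flip
            (singularHomology.coeffChange (Motives.ComplexPoints X)
              (algebraMap ℤ ℝ : ℤ →+* ℝ).toAddMonoidHom (2 * n) μ.fundamentalClass))) ∘ₗ
          lefschetzPowTo (reClass (Motives.ComplexPoints X) 2 D.Hη) r k m hm)).restrict U) = 0 := by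
  obtain ⟨h1, h2, -⟩ := D.signature_lefschetzForm_restrict_pq_eq_sum_hodgeNumber hX A (zero_add k)
    hk0 hk hkr hm hdeg μ hP U hU
  rw [zero_add, Finset.sum_range_one, if_pos (Nat.zero_mod 2), if_neg (lt_irrefl 0), sub_zero] at h1
  rw [zero_add, Finset.sum_range_one, if_neg (by decide), mul_zero] at h2
  have e1 : Module.finrank ℂ (A.hodgePQ (0 + (0 + (k - 0))) 0 (0 + (k - 0))) =
      Module.finrank ℂ (A.hodgePQ k 0 k) := by
    rw [Nat.sub_zero, Nat.zero_add, Nat.zero_add]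
  rw [e1] at h1
  constructor <;> omega

end KaehlerRationalDatum

end HodgePairs

end Literature.AlgebraicGeometry.HodgeTheory

end
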